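import Mathlib.Tactic
import Mathlib.RingTheory.Int.Basic
import Mathlib.Data.Rat.Lemmas

/-!
# Route `Langlands/SqrtFiveQuarticCovers`, sheet 4.5 row 8 — 2-isogeny descent ALGEBRA (generic)

Elementary, group-law-free algebra of the complete 2-isogeny descent for an elliptic curve with a
rational 2-torsion point, `E : y² = x(x² + a x + b)` (`b ≠ 0`, `a² − 4b ≠ 0`), and its 2-isogenous
curve `E' : Y² = X(X² − 2a X + (a² − 4b))`, as used by the Fermat-style descent for
`W = 49.a1` (`a, b = 294, −343`) and `W⁵ = 1225.c1` (`a, b = 1470, −8575`) in the sibling modules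
`…E7DescentW.lean` / `…E7DescentW5.lean` (eng-8 g3, cell lg-quartmod).  Everything here is an identity
in a field or an elementary divisibility statement in `ℤ`; nothing is specific to modularity.

* §1 x-coordinate maps `x_φ(t) = (t² + a t + b)/t`, `x_ψ(s) = (s² − 2a s + a² − 4b)/(4s)` (written
  out, no definitions): `x_ψ(x_φ(t)) = (t² − b)² / (4 t (t² + a t + b))` (`= x(2P)`), invariance of
  both under the translations `t ↦ b/t`, `s ↦ (a² − 4b)/s`, and the translated point is on the curve.
* §2 HALVING: a point of `E` whose `x` is a nonzero square `w²` is `ψ` of the explicit point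
  `X = a + 2w² + 2z` of `E'` (`z = y/w`); a point of `E'` whose `X` is a nonzero square `W²` is `φ` of
  the explicit point `x₁ = (W² − a + Z)/2` of `E` (`Z = Y/W`).
* §3 CLASS LEMMA over `ℚ`: an affine point `(x, y)`, `x ≠ 0`, of `y² = x(x² + a x + b)` with
  `a b : ℤ` has `x = ± g·s²/e²` with `g ∣ b`, `gcd(s, e) = 1`, and then
  `d s⁴ + a s² e² + (b/d) e⁴` is a square (`d = ±g`).

HONEST STATUS: kernel algebra only; no named input; not a modularity statement. References: Silverman–Tate,
*Rational Points on Elliptic Curves*, III.4–III.5 (the maps `φ`, `ψ` and the homomorphism `α`);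
cell record NAMED-INPUT-TABLE row 8.
-/

set_option linter.dupNamespace false -- project-wide option; `Summit.Langlands.Langlands` is the mandated namespace

namespace Summit.Langlands.Langlands.Theorems.SqrtFiveQuarticCovers

/-! ### §1 The `x`-coordinate maps of `φ : E → E'` and `ψ : E' → E` -/

section FieldIdentities

variable {F : Type*} [Field F] [CharZero F]

/-- `x_ψ(x_φ(t)) = (t² − b)²/(4t(t² + at + b))` — the `x`-coordinate of `2P` (duplication through the
2-isogeny and its dual). [folklore] -/
theorem descent_xpsi_xphi (a b t : F) (ht : t ≠ 0) :
    (((t ^ 2 + a * t + b) / t) ^ 2 - 2 * a * ((t ^ 2 + a * t + b) / t) + (a ^ 2 - 4 * b))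
        / (4 * ((t ^ 2 + a * t + b) / t))
      = (t ^ 2 - b) ^ 2 / (4 * (t * (t ^ 2 + a * t + b))) := by
  field_simp
  ring

omit [CharZero F] in
/-- Translation by the 2-torsion point `T = (0,0)` is `t ↦ b/t` on `x`; `x_φ` is invariant. [folklore] -/
theorem descent_xphi_transl (a b t : F) (ht : t ≠ 0) (hb : b ≠ 0) :
    ((b / t) ^ 2 + a * (b / t) + b) / (b / t) = (t ^ 2 + a * t + b) / t := by
  field_simp
  ring

/-- The translate `(b/t, −b y/t²)` of an affine point `(t, y)`, `t ≠ 0`, lies on the curve. [folklore] -/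
theorem descent_transl_onCurve (a b : F) {t y : F} (ht : t ≠ 0)
    (hy : y ^ 2 = t * (t ^ 2 + a * t + b)) :
    (b * y / t ^ 2) ^ 2 = (b / t) * ((b / t) ^ 2 + a * (b / t) + b) := by
  rw [show (b * y / t ^ 2) ^ 2 = b ^ 2 * y ^ 2 / t ^ 4 by ring, hy]
  field_simp
  ring

/-- If `b < 0`... (sign facts are curve-specific and live in the sibling files). Real positivity on
`E'`: if `X ≠ 0`, `X(X² + a'X + b') = Y²` and `X² + a'X + b' > 0` then `X > 0` (ordered field).
[folklore] -/
theorem descent_pos_of_onCurve {K : Type*} [Field K] [LinearOrder K] [IsStrictOrderedRing K]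
    {a' b' X Y : K} (hX : X ≠ 0)
    (hY : Y ^ 2 = X * (X ^ 2 + a' * X + b')) (hpos : 0 < X ^ 2 + a' * X + b') : 0 < X := by
  by_contra h
  have hXneg : X < 0 := lt_of_le_of_ne (not_lt.mp h) hX
  have : X * (X ^ 2 + a' * X + b') < 0 := mul_neg_of_neg_of_pos hXneg hpos
  nlinarith [sq_nonneg Y]

/-! ### §2 Halving through `ψ` and through `φ` -/

/-- **`ψ`-halving.**  If `(x, y) ∈ E`, `x = w² ≠ 0`, `z = y/w`, then `X := a + 2w² + 2z` is a NONZERO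
(`X·X̄ = a² − 4b`) `X`-coordinate of a rational point `(X, 2wX)` of `E' : Y² = X(X² − 2aX + a² − 4b)`
with `x_ψ(X) = x`. [folklore] -/
theorem descent_psi_halve {a b x y w : F} (hb' : a ^ 2 - 4 * b ≠ 0)
    (hx : x = w ^ 2) (hw : w ≠ 0) (hy : y ^ 2 = x * (x ^ 2 + a * x + b)) :
    (a + 2 * w ^ 2 + 2 * (y / w)) ≠ 0 ∧
    (2 * w * (a + 2 * w ^ 2 + 2 * (y / w))) ^ 2 =
      (a + 2 * w ^ 2 + 2 * (y / w)) * ((a + 2 * w ^ 2 + 2 * (y / w)) ^ 2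
        - 2 * a * (a + 2 * w ^ 2 + 2 * (y / w)) + (a ^ 2 - 4 * b)) ∧
    ((a + 2 * w ^ 2 + 2 * (y / w)) ^ 2 - 2 * a * (a + 2 * w ^ 2 + 2 * (y / w)) + (a ^ 2 - 4 * b))
        / (4 * (a + 2 * w ^ 2 + 2 * (y / w))) = x := by
  have hz : (y / w) ^ 2 = w ^ 4 + a * w ^ 2 + b := by
    field_simp
    rw [hx] at hy
    linear_combination hy
  have hprod : (a + 2 * w ^ 2 + 2 * (y / w)) * (a + 2 * w ^ 2 - 2 * (y / w)) = a ^ 2 - 4 * b := by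
    linear_combination (-4) * hz
  have hX : (a + 2 * w ^ 2 + 2 * (y / w)) ≠ 0 := by
    intro h0
    apply hb'
    rw [← hprod, h0, zero_mul]
  have hcurve : (a + 2 * w ^ 2 + 2 * (y / w)) ^ 2 - 2 * a * (a + 2 * w ^ 2 + 2 * (y / w))
      + (a ^ 2 - 4 * b) = 4 * w ^ 2 * (a + 2 * w ^ 2 + 2 * (y / w)) := by
    linear_combination 4 * hz
  refine ⟨hX, ?_, ?_⟩
  · rw [hcurve]; ring
  · rw [hcurve, hx,
      show 4 * w ^ 2 * (a + 2 * w ^ 2 + 2 * (y / w)) = w ^ 2 * (4 * (a + 2 * w ^ 2 + 2 * (y / w))) by ring]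
    exact mul_div_cancel_right₀ _ (mul_ne_zero (by norm_num) hX)

/-- **`φ`-halving.**  If `(X, Y) ∈ E' : Y² = X(X² − 2aX + a² − 4b)`, `X = W² ≠ 0`, `Z = Y/W`, then
`x₁ := (W² − a + Z)/2` is a NONZERO (`x₁·x̄₁ = b`) `x`-coordinate of a rational point `(x₁, W x₁)`
of `E : y² = x(x² + ax + b)` with `x_φ(x₁) = X`. [folklore] -/
theorem descent_phi_halve {a b X Y W : F} (hb : b ≠ 0)
    (hX : X = W ^ 2) (hW : W ≠ 0) (hY : Y ^ 2 = X * (X ^ 2 - 2 * a * X + (a ^ 2 - 4 * b))) :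
    (W ^ 2 - a + Y / W) / 2 ≠ 0 ∧
    (W * ((W ^ 2 - a + Y / W) / 2)) ^ 2 =
      ((W ^ 2 - a + Y / W) / 2) * (((W ^ 2 - a + Y / W) / 2) ^ 2 + a * ((W ^ 2 - a + Y / W) / 2) + b) ∧
    (((W ^ 2 - a + Y / W) / 2) ^ 2 + a * ((W ^ 2 - a + Y / W) / 2) + b) / ((W ^ 2 - a + Y / W) / 2)
      = X := by
  have hZ : (Y / W) ^ 2 = (W ^ 2 - a) ^ 2 - 4 * b := by
    field_simp
    rw [hX] at hY
    linear_combination hY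
  have hprod : ((W ^ 2 - a + Y / W) / 2) * ((W ^ 2 - a - Y / W) / 2) = b := by
    linear_combination (-1 / 4 : F) * hZ
  have hx1 : (W ^ 2 - a + Y / W) / 2 ≠ 0 := by
    intro h0
    apply hb
    rw [← hprod, h0, zero_mul]
  -- `x₁` is a root of `t² + (a − W²) t + b`
  have hroot : ((W ^ 2 - a + Y / W) / 2) ^ 2 + a * ((W ^ 2 - a + Y / W) / 2) + b
      = W ^ 2 * ((W ^ 2 - a + Y / W) / 2) := by
    linear_combination (1 / 4 : F) * hZ
  refine ⟨hx1, ?_, ?_⟩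
  · rw [hroot]; ring
  · rw [hroot, hX]
    exact mul_div_cancel_right₀ _ hx1

end FieldIdentities

/-! ### §3 The class lemma over `ℚ` -/

/-- A positive natural number whose cube is a square is a square: `n³ = q²` ⇒ `∃ w, n = w²`.
[folklore] -/
theorem nat_sq_of_cube_eq_sq {n q : ℕ} (hn : 0 < n) (h : n ^ 3 = q ^ 2) : ∃ w : ℕ, n = w ^ 2 := by
  have hdvd : n ^ 2 ∣ q ^ 2 := ⟨n, by rw [← h]; ring⟩
  have hnq : n ∣ q := (Nat.pow_dvd_pow_iff two_ne_zero).mp hdvd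
  obtain ⟨w, rfl⟩ := hnq
  refine ⟨w, ?_⟩
  have h' : n ^ 2 * n = n ^ 2 * w ^ 2 := by linear_combination h
  exact mul_left_cancel₀ (pow_ne_zero 2 hn.ne') h'

/-- **Denominators.**  If `x = m/n` in lowest terms (`n > 0`) and `x(x² + a x + b)` (`a b : ℤ`) is the
square of a rational number, then `n = e²` is a perfect square and `m(m² + a m n + b n²)` is the square
of an integer. [folklore] -/
theorem descent_den_sq {a b m : ℤ} {n : ℕ} (hn : 0 < n) (hcop : Int.gcd m n = 1) {y : ℚ}
    (hy : y ^ 2 = (m / n : ℚ) * ((m / n : ℚ) ^ 2 + a * (m / n : ℚ) + b)) :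
    ∃ (e : ℕ) (p : ℤ), 0 < e ∧ n = e ^ 2 ∧ m * (m ^ 2 + a * m * n + b * n ^ 2) = p ^ 2 := by
  -- clear denominators: `(y.num)² n³ = K (y.den)²`, `K = m(m² + a m n + b n²)`
  set K : ℤ := m * (m ^ 2 + a * m * n + b * n ^ 2) with hK
  have hnQ : (n : ℚ) ≠ 0 := by exact_mod_cast hn.ne'
  have hyq : y = y.num / y.den := (Rat.num_div_den y).symm
  have hden : (y.den : ℚ) ≠ 0 := by exact_mod_cast y.den_nz
  have hZ : (y.num : ℤ) ^ 2 * (n : ℤ) ^ 3 = K * (y.den : ℤ) ^ 2 := by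
    have hQ : ((y.num : ℤ) ^ 2 * (n : ℤ) ^ 3 : ℚ) = ((K * (y.den : ℤ) ^ 2 : ℤ) : ℚ) := by
      push_cast
      rw [hyq] at hy
      field_simp at hy
      rw [hK]; push_cast
      linear_combination hy
    exact_mod_cast hQ
  -- `gcd(K, n) = 1`
  have hKn : Int.gcd K n = 1 := by
    have h1 : IsCoprime m (n : ℤ) := Int.isCoprime_iff_gcd_eq_one.mpr hcop
    have h2 : IsCoprime (m ^ 2 + a * m * n + b * n ^ 2) (n : ℤ) := by
      have : IsCoprime (m ^ 2) (n : ℤ) := h1.pow_left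
      have h3 : m ^ 2 + a * m * n + b * n ^ 2 = m ^ 2 + (n : ℤ) * (a * m + b * n) := by ring
      rw [h3]
      exact this.add_mul_left_left _
    exact Int.isCoprime_iff_gcd_eq_one.mp (h1.mul_left h2)
  -- `n³ ∣ K den²` and coprime ⇒ `n³ ∣ den²`; `den² ∣ num² n³` and coprime ⇒ `den² ∣ n³`
  have hypq : Int.gcd y.num y.den = 1 := y.reduced
  have h1 : ((n : ℤ) ^ 3) ∣ (y.den : ℤ) ^ 2 := by
    have hd : ((n : ℤ) ^ 3) ∣ K * (y.den : ℤ) ^ 2 := ⟨y.num ^ 2, by rw [← hZ]; ring⟩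
    have hc : IsCoprime ((n : ℤ) ^ 3) K :=
      (Int.isCoprime_iff_gcd_eq_one.mpr (by rw [Int.gcd_comm]; exact hKn)).pow_left
    exact hc.dvd_of_dvd_mul_left hd
  have h2 : (y.den : ℤ) ^ 2 ∣ (n : ℤ) ^ 3 := by
    have hd : (y.den : ℤ) ^ 2 ∣ (y.num : ℤ) ^ 2 * (n : ℤ) ^ 3 := ⟨K, by rw [hZ]; ring⟩
    have hc : IsCoprime ((y.den : ℤ) ^ 2) ((y.num : ℤ) ^ 2) :=
      (Int.isCoprime_iff_gcd_eq_one.mpr (by rw [Int.gcd_comm]; exact hypq)).pow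
    exact hc.dvd_of_dvd_mul_left hd
  have h3 : (n : ℤ) ^ 3 = (y.den : ℤ) ^ 2 :=
    Int.dvd_antisymm (by positivity) (by positivity) h1 h2
  have h3N : n ^ 3 = y.den ^ 2 := by exact_mod_cast h3
  obtain ⟨e, he⟩ := nat_sq_of_cube_eq_sq hn h3N
  refine ⟨e, y.num, ?_, he, ?_⟩
  · rcases Nat.eq_zero_or_pos e with h0 | h0
    · exfalso; rw [h0] at he; simp at he; omega
    · exact h0
  · -- `K = num²` since `n³ = den² ≠ 0`
    have hne : (y.den : ℤ) ^ 2 ≠ 0 := by positivity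
    have : K * (y.den : ℤ) ^ 2 = (y.num) ^ 2 * (y.den : ℤ) ^ 2 := by rw [← hZ, h3]
    exact mul_right_cancel₀ hne this

/-- **The class lemma.**  For `a b : ℤ`, `b ≠ 0`, and an affine point `(x, y)` with `x ≠ 0` of
`y² = x(x² + a x + b)` over `ℚ`: `x = ± g·s²/e²` with `g ∣ b` a positive divisor, `e > 0`,
`s ≠ 0`, `gcd(s, e) = 1`, and `± g·s⁴ + a s² e² + (b/(±g)) e⁴` a perfect square — precisely: there is
`N` with `(d·s)²·(d s⁴ + a s² e² + b' e⁴) = (d s · N)²` where `d = ±g`, `d·b' = b`.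
(Silverman–Tate III.5: `x = m/e²`, `m·(m² + a m e² + b e⁴) = □`, `gcd(m, m² + a m e² + b e⁴) ∣ b`,
coprime factors of a square are ± squares — `Int.sq_of_gcd_eq_one`.) [folklore] -/
theorem descent_class {a b : ℤ} {x y : ℚ} (hx : x ≠ 0)
    (hy : y ^ 2 = x * (x ^ 2 + a * x + b)) :
    ∃ (d b' s N : ℤ) (e : ℕ), d * b' = b ∧ 0 < e ∧ s ≠ 0 ∧ Int.gcd s e = 1 ∧ Int.gcd d e = 1 ∧
      x = (d : ℚ) * s ^ 2 / e ^ 2 ∧ N ^ 2 = d * s ^ 4 + a * s ^ 2 * e ^ 2 + b' * e ^ 4 := by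
  -- `x = m/n` in lowest terms
  set m : ℤ := x.num with hm
  set n : ℕ := x.den with hn
  have hn0 : 0 < n := x.den_pos
  have hcop : Int.gcd m n = 1 := x.reduced
  have hxmn : x = (m / n : ℚ) := (Rat.num_div_den x).symm
  have hm0 : m ≠ 0 := by rw [hm]; exact Rat.num_ne_zero.mpr hx
  rw [hxmn] at hy
  obtain ⟨e, p, he, hne, hKp⟩ := descent_den_sq hn0 hcop hy
  -- `g = gcd(m, q)`, `q = m² + a m n + b n²`; `m = m₁ g`, `q = q₁ g`, `gcd(m₁, q₁) = 1`
  set q : ℤ := m ^ 2 + a * m * n + b * n ^ 2 with hq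
  have hg0 : 0 < Int.gcd m q := Int.gcd_pos_of_ne_zero_left _ hm0
  obtain ⟨m₁, q₁, hcop1, hm₁, hq₁⟩ := Int.exists_gcd_one hg0
  set g : ℕ := Int.gcd m q with hg
  have hgZ : (g : ℤ) ≠ 0 := by exact_mod_cast hg0.ne'
  -- `g ∣ b`
  have hgb : (g : ℤ) ∣ b := by
    have hgm : (g : ℤ) ∣ m := ⟨m₁, by rw [hm₁]; ring⟩
    have hgq : (g : ℤ) ∣ q := ⟨q₁, by rw [hq₁]; ring⟩
    have h1 : (g : ℤ) ∣ b * (n : ℤ) ^ 2 := by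
      have : b * (n : ℤ) ^ 2 = q - m * (m + a * n) := by rw [hq]; ring
      rw [this]; exact dvd_sub hgq (dvd_mul_of_dvd_left hgm _)
    have hgn : Int.gcd (g : ℤ) ((n : ℤ) ^ 2) = 1 := by
      have : Int.gcd (g : ℤ) n ∣ Int.gcd m n :=
        Int.dvd_gcd ((Int.gcd_dvd_left _ _).trans hgm) (Int.gcd_dvd_right _ _)
      rw [hcop, Nat.dvd_one] at this
      have hc : IsCoprime (g : ℤ) (n : ℤ) := Int.isCoprime_iff_gcd_eq_one.mpr this
      exact Int.isCoprime_iff_gcd_eq_one.mp hc.pow_right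
    exact Int.dvd_of_dvd_mul_left_of_gcd_one h1 hgn
  -- `gcd(g, e) = 1`
  have hge : Int.gcd (g : ℤ) e = 1 := by
    have hgm : (g : ℤ) ∣ m := ⟨m₁, by rw [hm₁]; ring⟩
    have hen : (e : ℤ) ∣ (n : ℤ) := ⟨e, by rw [hne]; push_cast; ring⟩
    have : Int.gcd (g : ℤ) e ∣ Int.gcd m n :=
      Int.dvd_gcd ((Int.gcd_dvd_left _ _).trans hgm) ((Int.gcd_dvd_right _ _).trans hen)
    rw [hcop, Nat.dvd_one] at this
    exact this
  -- `m₁ q₁ = p₁²`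
  have hgp : (g : ℤ) ∣ p := by
    have : (g : ℤ) ^ 2 ∣ p ^ 2 := ⟨m₁ * q₁, by rw [← hKp, hm₁, hq₁]; ring⟩
    exact (Int.pow_dvd_pow_iff two_ne_zero).mp this
  obtain ⟨p₁, hp₁⟩ := hgp
  have hprod : m₁ * q₁ = p₁ ^ 2 := by
    have h0 := hKp
    rw [hm₁, hq₁, hp₁] at h0
    have : (g : ℤ) ^ 2 * (m₁ * q₁) = (g : ℤ) ^ 2 * p₁ ^ 2 := by linear_combination h0
    exact mul_left_cancel₀ (pow_ne_zero 2 hgZ) this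
  obtain ⟨s, hs⟩ := Int.sq_of_gcd_eq_one hcop1 hprod
  have hm1ne : m₁ ≠ 0 := by rintro rfl; exact hm0 (by rw [hm₁, zero_mul])
  have hs0 : s ≠ 0 := by
    rintro rfl
    rcases hs with h | h <;> exact hm1ne (by rw [h]; ring)
  -- `gcd(s, e) = 1` since `s ∣ m`, `e ∣ n`
  have hse : Int.gcd s e = 1 := by
    have hsm : s ∣ m := by
      rcases hs with h | h
      · exact ⟨s * g, by rw [hm₁, h]; ring⟩
      · exact ⟨-(s * g), by rw [hm₁, h]; ring⟩
    have hen : (e : ℤ) ∣ (n : ℤ) := ⟨e, by rw [hne]; push_cast; ring⟩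
    have : Int.gcd s e ∣ Int.gcd m n :=
      Int.dvd_gcd ((Int.gcd_dvd_left _ _).trans hsm) ((Int.gcd_dvd_right _ _).trans hen)
    rw [hcop, Nat.dvd_one] at this
    exact this
  -- `s ∣ p₁`, `p₁ = s N`
  have hsp : s ∣ p₁ := by
    have : s ^ 2 ∣ p₁ ^ 2 := by
      rcases hs with h | h
      · exact ⟨q₁, by rw [← hprod, h]⟩
      · exact ⟨-q₁, by rw [← hprod, h]; ring⟩
    exact (Int.pow_dvd_pow_iff two_ne_zero).mp this
  obtain ⟨N, hN⟩ := hsp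
  obtain ⟨b', hb'⟩ := hgb
  have hqexp : q = m ^ 2 + a * m * (e : ℤ) ^ 2 + b * (e : ℤ) ^ 4 := by
    rw [hq, hne]; push_cast; ring
  rcases hs with h | h
  · -- `m = g s²`: `d = g`, `b' = b/g`, `q₁ = g s⁴ + a s² e² + b' e⁴ = N²`
    refine ⟨g, b', s, N, e, hb'.symm, he, hs0, hse, hge, ?_, ?_⟩
    · rw [hxmn, hm₁, h, hne]; push_cast; ring
    · have hq1 : q₁ = (g : ℤ) * s ^ 4 + a * s ^ 2 * e ^ 2 + b' * e ^ 4 := by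
        have : (g : ℤ) * q₁ = (g : ℤ) * ((g : ℤ) * s ^ 4 + a * s ^ 2 * e ^ 2 + b' * e ^ 4) := by
          have h2 := hqexp
          rw [hq₁, hm₁, h, hb'] at h2
          linear_combination h2
        exact mul_left_cancel₀ hgZ this
      have : s ^ 2 * N ^ 2 = s ^ 2 * ((g : ℤ) * s ^ 4 + a * s ^ 2 * e ^ 2 + b' * e ^ 4) := by
        rw [← hq1]
        have h3 := hprod
        rw [h, hN] at h3
        linear_combination -h3
      exact mul_left_cancel₀ (pow_ne_zero 2 hs0) this
  · -- `m = −g s²`: `d = −g`, `b/d = −b'`, `−q₁ = N²`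
    refine ⟨-(g : ℤ), -b', s, N, e, by rw [hb']; ring, he, hs0, hse, by
        show Nat.gcd (-(g : ℤ)).natAbs _ = 1
        rw [Int.natAbs_neg]; exact hge, ?_, ?_⟩
    · rw [hxmn, hm₁, h, hne]; push_cast; ring
    · have hq1 : q₁ = (g : ℤ) * s ^ 4 - a * s ^ 2 * e ^ 2 + b' * e ^ 4 := by
        have : (g : ℤ) * q₁ = (g : ℤ) * ((g : ℤ) * s ^ 4 - a * s ^ 2 * e ^ 2 + b' * e ^ 4) := by
          have h2 := hqexp
          rw [hq₁, hm₁, h, hb'] at h2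
          linear_combination h2
        exact mul_left_cancel₀ hgZ this
      have : s ^ 2 * N ^ 2 = s ^ 2 * (-(g : ℤ) * s ^ 4 + a * s ^ 2 * e ^ 2 + (-b') * e ^ 4) := by
        have h3 := hprod
        rw [h, hN, hq1] at h3
        linear_combination -h3
      exact mul_left_cancel₀ (pow_ne_zero 2 hs0) this

/-! ### §4 Small helpers used by the two descents -/

/-- **Lowest-terms triple of a point with square abscissa.**  If `x = r²`, `r ≠ 0`, and
`y² = x(x² + a x + b)` (`a b : ℤ`), then with `M = |num r|`, `e = den r`: `0 < M`, `0 < e`,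
`gcd(M, e) = 1`, `x = M²/e²` and `M⁴ + a M² e² + b e⁴ = N²` for some integer `N`. [folklore] -/
theorem descent_triple_of_sq {a b : ℤ} {x y r : ℚ} (hr : r ≠ 0) (hx : x = r ^ 2)
    (hy : y ^ 2 = x * (x ^ 2 + a * x + b)) :
    ∃ (M e : ℕ) (N : ℤ), 0 < M ∧ 0 < e ∧ Nat.Coprime M e ∧ x = (M : ℚ) ^ 2 / (e : ℚ) ^ 2 ∧
      N ^ 2 = (M : ℤ) ^ 4 + a * M ^ 2 * e ^ 2 + b * e ^ 4 := by
  set nu : ℤ := r.num with hnu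
  set de : ℕ := r.den with hde
  refine ⟨nu.natAbs, de, ?_⟩
  have hM : 0 < nu.natAbs := Int.natAbs_pos.mpr (Rat.num_ne_zero.mpr hr)
  have he : 0 < de := r.den_pos
  have hcop : Nat.Coprime nu.natAbs de := r.reduced
  have hrq : r = nu / de := (Rat.num_div_den r).symm
  have hdenQ : (de : ℚ) ≠ 0 := by exact_mod_cast r.den_nz
  have hnuQ : (nu : ℚ) ≠ 0 := by exact_mod_cast Rat.num_ne_zero.mpr hr
  have hMQ : ((nu.natAbs : ℕ) : ℚ) = |(nu : ℚ)| := by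
    rw [Nat.cast_natAbs, Int.cast_abs]
  have hMQ2 : ((nu.natAbs : ℕ) : ℚ) ^ 2 = (nu : ℚ) ^ 2 := by rw [hMQ, sq_abs]
  have hMQ4 : ((nu.natAbs : ℕ) : ℚ) ^ 4 = (nu : ℚ) ^ 4 := by
    rw [show (4 : ℕ) = 2 * 2 by norm_num, pow_mul, pow_mul, hMQ2]
  have hxM : x = ((nu.natAbs : ℕ) : ℚ) ^ 2 / (de : ℚ) ^ 2 := by
    rw [hMQ2, hx, ← div_pow, ← hrq]
  have hy' : y ^ 2 = ((nu : ℚ) / de) ^ 2 * ((((nu : ℚ) / de) ^ 2) ^ 2 + a * ((nu : ℚ) / de) ^ 2 + b) := by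
    rw [hy, hx, hrq]
  -- the integer `N`
  have hsq : IsSquare (((nu.natAbs : ℕ) : ℤ) ^ 4 + a * (nu.natAbs : ℕ) ^ 2 * de ^ 2 + b * de ^ 4 : ℤ) := by
    have key : ((((nu.natAbs : ℕ) : ℤ) ^ 4 + a * (nu.natAbs : ℕ) ^ 2 * de ^ 2 + b * de ^ 4 : ℤ) : ℚ)
        = (y * de ^ 3 / (nu : ℚ)) ^ 2 := by
      have e1 : ((((nu.natAbs : ℕ) : ℤ) ^ 4 + a * (nu.natAbs : ℕ) ^ 2 * de ^ 2 + b * de ^ 4 : ℤ) : ℚ)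
          = ((nu.natAbs : ℕ) : ℚ) ^ 4 + (a : ℚ) * ((nu.natAbs : ℕ) : ℚ) ^ 2 * (de : ℚ) ^ 2
            + (b : ℚ) * (de : ℚ) ^ 4 := by
        push_cast; rw [hMQ]
      rw [e1, hMQ4, hMQ2]
      field_simp
      field_simp at hy'
      linear_combination -hy'
    have : IsSquare ((((nu.natAbs : ℕ) : ℤ) ^ 4 + a * (nu.natAbs : ℕ) ^ 2 * de ^ 2 + b * de ^ 4 : ℤ) : ℚ) :=
      ⟨y * de ^ 3 / (nu : ℚ), by rw [key]; ring⟩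
    exact Rat.isSquare_intCast_iff.mp this
  obtain ⟨N, hN⟩ := hsq
  refine ⟨N, hM, he, hcop, hxM, ?_⟩
  rw [sq]
  exact hN.symm

/-- Transport of divisibility through `ZMod m`: for `m = k·d`, `k·M ≡ 0 (mod m)` iff `d ∣ M`.
[folklore] -/
theorem zmod_mul_intCast_eq_zero_iff {m k d : ℕ} (hm : m = k * d) (hk : 0 < k) (M : ℤ) :
    (k : ZMod m) * (M : ZMod m) = 0 ↔ (d : ℤ) ∣ M := by
  rw [show (k : ZMod m) * (M : ZMod m) = ((k * M : ℤ) : ZMod m) by push_cast; ring,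
    ZMod.intCast_zmod_eq_zero_iff_dvd, hm, Nat.cast_mul]
  exact Int.mul_dvd_mul_iff_left (by exact_mod_cast hk.ne')

/-- `2 ∣ M`, `2 ∣ e` contradicts `gcd(M, e) = 1`; stated for a general prime-free `d > 1`.
[folklore] -/
theorem false_of_dvd_of_dvd_of_gcd_eq_one {d : ℕ} {M e : ℤ} (hd : 1 < d) (hM : (d : ℤ) ∣ M)
    (he : (d : ℤ) ∣ e) (h : Int.gcd M e = 1) : False := by
  have : d ∣ Int.gcd M e := Int.dvd_gcd hM he
  rw [h] at this
  have := Nat.le_of_dvd one_pos this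
  omega

end Summit.Langlands.Langlands.Theorems.SqrtFiveQuarticCovers
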